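import Literature.NumberTheory.Automorphic.QuaternionRamificationParityHolds
import Literature.NumberTheory.QuadraticForms.HilbertSymbolArchimedean
import Literature.NumberTheory.AdelicBaseChange.CompletionBaseChange
import HarnessLib

/-!
# Hilbert reciprocity over `F` and over `ℚ`, compared fibrewise: the dyadic identity
# `∏_{w ∣ 2} (a, β)_w = (a, N_{F/ℚ} β)_2` from the same identity at every odd prime

Topic `NumberTheory/QuadraticForms`; namespace `Literature.NumberTheory.QuadraticForms`; a *proofs* file
(theorems only, no definition, no named fact).  Cell `hodgecm-mathlib`, row III-11c (the «global road» to
the projection formula `(a, b)_{F_𝔭} = (a, N_{F_𝔭/ℚ₂} b)_{ℚ₂}` for COMPLETIONS of number fields, replacing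
the printed local-class-field-theory residual `HilbertSymbolNormCompatAtTwo` of
`HilbertSymbolNormCompat.lean` in its only consumer).

For a number field `F`, a natural number `a > 0` and `β ∈ Fˣ`, Hilbert's reciprocity law (O'Meara 71:18,
the tree's THEOREM `hilbertReciprocity_holds`) for the pair `(a, β)` over `F` and for the pair
`(a, N_{F/ℚ} β)` over `ℚ` says that both `∏_w (a, β)_{F_w}` and `∏_v (a, N β)_{ℚ_v}` (all places) are `1`;
`a > 0` makes every archimedean symbol `+1`.  Grouping the finite places `w` of `F` by the rational prime
`v` below them: **if `∏_{w ∣ v} (a, β)_{F_w} = (a, N_{F/ℚ} β)_{ℚ_v}` at every ODD `v`, then also at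
`v = 2`** (`prod_hilbertSymbol_two_eq_of_forall_odd`).  This is the book-keeping step of the classical
derivation of the norm-functoriality of the norm residue symbol at ONE place from the reciprocity law and
the functoriality at all OTHER places (Neukirch, *Algebraic Number Theory*, VI §5 / V (3.1) for the
statement being reduced; O'Meara §71 for the reciprocity law used).

## References
* [Omeara1963] O. T. O'Meara, *Introduction to quadratic forms* (1963), §63B, §71 Thm. 71:18.
* [NeukirchANT1999] J. Neukirch, *Algebraic Number Theory* (1999), Ch. V (3.1), Ch. VI (5.7).
-/

noncomputable section

open scoped Classical
open NumberField IsDedekindDomain IsDedekindDomain.HeightOneSpectrum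

namespace Literature.NumberTheory.QuadraticForms

variable (F : Type) [Field F] [NumberField F]

/-- At an archimedean place `w` of a number field `K`, the symbol `(a, b)_w` is `+1` as soon as `a` is a
POSITIVE natural number (a square in `ℝ`; complex places never give `-1`). [cite: Omeara1963, §63B] -/
theorem hilbertSymbol_completion_natCast_ne_neg_one {K : Type*} [Field K] [NumberField K]
    (w : InfinitePlace K) {a : ℕ} (ha : 0 < a) (b : K) :
    hilbertSymbol w.Completion (algebraMap K _ (a : K)) (algebraMap K _ b) ≠ -1 := by
  intro h
  rcases w.isReal_or_isComplex with hw | hw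
  · have h1 := (hilbertSymbol_completion_eq_one_iff_of_isReal (w := w) hw (a : K) b).2
      (Or.inl (by rw [map_natCast]; exact_mod_cast ha))
    rw [h1] at h
    norm_num at h
  · have hne : (a : K) ≠ 0 := by exact_mod_cast ha.ne'
    rw [hilbertSymbol_completion_eq_one_of_isComplex (w := w) hw (Or.inl hne)] at h
    norm_num at h

/-- Hilbert reciprocity for `(a, b)` with `a` a positive natural number: the finite places `w` of `K` with
`(a, b)_w = -1` form a finite set of EVEN cardinality (the archimedean symbols are all `+1`).
[cite: Omeara1963, §71 Thm. 71:18] -/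
theorem even_ncard_hilbertSymbol_natCast_eq_neg_one {K : Type} [Field K] [NumberField K]
    {a : ℕ} (ha : 0 < a) {b : K} (hb : b ≠ 0) :
    {v : HeightOneSpectrum (𝓞 K) |
        hilbertSymbol (v.adicCompletion K) (a : v.adicCompletion K) (algebraMap K _ b) = -1}.Finite ∧
      Even {v : HeightOneSpectrum (𝓞 K) |
        hilbertSymbol (v.adicCompletion K) (a : v.adicCompletion K) (algebraMap K _ b) = -1}.ncard := by
  have ha0 : (a : K) ≠ 0 := by exact_mod_cast ha.ne'
  obtain ⟨hfin, heven⟩ := hilbertReciprocity_holds K (a : K) b ha0 hb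
  have hinf : {w : InfinitePlace K |
      hilbertSymbol w.Completion (algebraMap K _ (a : K)) (algebraMap K _ b) = -1} = ∅ :=
    Set.eq_empty_iff_forall_notMem.2 fun w hw ↦ hilbertSymbol_completion_natCast_ne_neg_one w ha b hw
  rw [hinf, Set.ncard_empty, add_zero] at heven
  simp only [map_natCast] at hfin heven
  exact ⟨hfin, heven⟩

/-- The product of the symbols `(a, β)_w` over the places `w ∣ v` of `F`, as a product over the finite
subtype `v.Extension (𝓞 F)` of the packet, equals the product over the fibre of `w ↦ w ∩ ℚ` above `v`
inside any finite set of places of `F` containing that fibre (private book-keeping helper). [folklore] -/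
private theorem prod_extension_eq_prod_filter (v : HeightOneSpectrum (𝓞 ℚ)) (f : HeightOneSpectrum (𝓞 F) → ℤ)
    (T : Finset (HeightOneSpectrum (𝓞 F))) (hT : ∀ w : HeightOneSpectrum (𝓞 F), w.under (𝓞 ℚ) = v → w ∈ T) :
    letI := Extension.fintype (𝓞 ℚ) ℚ F (𝓞 F) v
    (∏ w : v.Extension (𝓞 F), f w.1) = ∏ w ∈ T with w.under (𝓞 ℚ) = v, f w := by
  letI : Fintype {w : HeightOneSpectrum (𝓞 F) // w.under (𝓞 ℚ) = v} :=
    Extension.fintype (𝓞 ℚ) ℚ F (𝓞 F) v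
  change (∏ w : {w : HeightOneSpectrum (𝓞 F) // w.under (𝓞 ℚ) = v}, f w.1) = _
  rw [← Finset.prod_subtype (T.filter fun w => w.under (𝓞 ℚ) = v)]
  intro w
  simp only [Finset.mem_filter, and_iff_right_iff_imp]
  exact hT w

/-- **Book-keeping step of the global road.**  For a number field `F`, `a ∈ ℕ`, `a > 0`, `β ∈ Fˣ`: if
`∏_{w ∣ v} (a, β)_{F_w} = (a, N_{F/ℚ} β)_{ℚ_v}` at every finite place `v ≠ 2` of `ℚ`, then the same identity
holds at the dyadic place `v₂` — by Hilbert reciprocity for `(a, β)` over `F` and for `(a, N β)` over `ℚ`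
(`hilbertReciprocity_holds`), the archimedean symbols being `+1` because `a > 0`.
[cite: Omeara1963, §71 Thm. 71:18] [cite: NeukirchANT1999, Ch. VI (5.7) with Ch. V (3.1)] -/
theorem prod_hilbertSymbol_two_eq_of_forall_odd {a : ℕ} (ha : 0 < a) {β : F} (hβ : β ≠ 0)
    (v₂ : HeightOneSpectrum (𝓞 ℚ)) (hv₂ : (2 : 𝓞 ℚ) ∈ v₂.asIdeal)
    (hodd : ∀ v : HeightOneSpectrum (𝓞 ℚ), (2 : 𝓞 ℚ) ∉ v.asIdeal →
      letI := Extension.fintype (𝓞 ℚ) ℚ F (𝓞 F) v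
      (∏ w : v.Extension (𝓞 F),
          hilbertSymbol (w.1.adicCompletion F) (a : w.1.adicCompletion F) (algebraMap F _ β)) =
        hilbertSymbol (v.adicCompletion ℚ) (a : v.adicCompletion ℚ) (algebraMap ℚ _ (Algebra.norm ℚ β))) :
    letI := Extension.fintype (𝓞 ℚ) ℚ F (𝓞 F) v₂
    (∏ w : v₂.Extension (𝓞 F),
        hilbertSymbol (w.1.adicCompletion F) (a : w.1.adicCompletion F) (algebraMap F _ β)) =
      hilbertSymbol (v₂.adicCompletion ℚ) (a : v₂.adicCompletion ℚ) (algebraMap ℚ _ (Algebra.norm ℚ β)) := by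
  -- notation: `sF w = (a, β)_w`, `sQ v = (a, N β)_v`, `u w = w ∩ ℚ`
  set sF : HeightOneSpectrum (𝓞 F) → ℤ := fun w =>
    hilbertSymbol (w.adicCompletion F) (a : w.adicCompletion F) (algebraMap F _ β) with hsF
  set sQ : HeightOneSpectrum (𝓞 ℚ) → ℤ := fun v =>
    hilbertSymbol (v.adicCompletion ℚ) (a : v.adicCompletion ℚ) (algebraMap ℚ _ (Algebra.norm ℚ β)) with hsQ
  let u : HeightOneSpectrum (𝓞 F) → HeightOneSpectrum (𝓞 ℚ) := fun w => w.under (𝓞 ℚ)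
  have hN0 : Algebra.norm ℚ β ≠ 0 := Algebra.norm_ne_zero_iff.2 hβ
  -- Hilbert reciprocity twice
  obtain ⟨hBFfin, hBFeven⟩ := even_ncard_hilbertSymbol_natCast_eq_neg_one (K := F) ha hβ
  obtain ⟨hBQfin, hBQeven⟩ := even_ncard_hilbertSymbol_natCast_eq_neg_one (K := ℚ) ha hN0
  set BF := hBFfin.toFinset with hBF
  set BQ := hBQfin.toFinset with hBQ
  have hmemBF : ∀ w, w ∈ BF ↔ sF w = -1 := fun w => by rw [hBF, Set.Finite.mem_toFinset]; rfl
  have hmemBQ : ∀ v, v ∈ BQ ↔ sQ v = -1 := fun v => by rw [hBQ, Set.Finite.mem_toFinset]; rfl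
  -- the finite set `S` of rational places carrying everything, and the places `T` of `F` above `S`
  set S : Finset (HeightOneSpectrum (𝓞 ℚ)) := BF.image u ∪ BQ ∪ {v₂} with hS
  have hv₂S : v₂ ∈ S := by simp [hS]
  set T : Finset (HeightOneSpectrum (𝓞 F)) :=
    S.biUnion fun v => (letI := Extension.fintype (𝓞 ℚ) ℚ F (𝓞 F) v;
      (Finset.univ : Finset (v.Extension (𝓞 F))).map (Function.Embedding.subtype _)) with hTdef
  have hmemT : ∀ w : HeightOneSpectrum (𝓞 F), w ∈ T ↔ u w ∈ S := by
    intro w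
    constructor
    · intro hw
      rw [hTdef, Finset.mem_biUnion] at hw
      obtain ⟨v, hvS, hw⟩ := hw
      rw [Finset.mem_map] at hw
      obtain ⟨w', -, rfl⟩ := hw
      change w'.1.under (𝓞 ℚ) ∈ S
      rw [w'.2]
      exact hvS
    · intro hw
      rw [hTdef, Finset.mem_biUnion]
      refine ⟨u w, hw, ?_⟩
      rw [Finset.mem_map]
      exact ⟨⟨w, rfl⟩, @Finset.mem_univ _ (Extension.fintype (𝓞 ℚ) ℚ F (𝓞 F) (u w)) _, rfl⟩
  have hBFT : BF ⊆ T := fun w hw => (hmemT w).2 (by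
    rw [hS]; exact Finset.mem_union_left _ (Finset.mem_union_left _ (Finset.mem_image_of_mem u hw)))
  -- values are `±1`
  have hsF1 : ∀ w, w ∉ BF → sF w = 1 := fun w hw =>
    (hilbertSymbol_ne_neg_one_iff _ _).1 fun h => hw ((hmemBF w).2 h)
  have hsQ1 : ∀ v, v ∉ BQ → sQ v = 1 := fun v hv =>
    (hilbertSymbol_ne_neg_one_iff _ _).1 fun h => hv ((hmemBQ v).2 h)
  -- (1) `∏_{v ∈ S} ∏_{w ∣ v} sF w = ∏_{w ∈ T} sF w = ∏_{w ∈ BF} (-1) = 1`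
  have h1 : ∏ v ∈ S, (∏ w ∈ T with u w = v, sF w) = 1 := by
    rw [Finset.prod_fiberwise_of_maps_to (g := u) (fun w hw => (hmemT w).1 hw) sF]
    rw [← Finset.prod_subset hBFT (fun w _ hw => hsF1 w hw)]
    rw [Finset.prod_congr rfl (fun w hw => (hmemBF w).1 hw), Finset.prod_const,
      ← Set.ncard_eq_toFinset_card _ hBFfin]
    exact Even.neg_one_pow hBFeven
  -- (2) `∏_{v ∈ S} sQ v = ∏_{v ∈ BQ} (-1) = 1`
  have hBQS : BQ ⊆ S := fun v hv => by
    rw [hS]; exact Finset.mem_union_left _ (Finset.mem_union_right _ hv)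
  have h2 : ∏ v ∈ S, sQ v = 1 := by
    rw [← Finset.prod_subset hBQS (fun v _ hv => hsQ1 v hv)]
    rw [Finset.prod_congr rfl (fun v hv => (hmemBQ v).1 hv), Finset.prod_const,
      ← Set.ncard_eq_toFinset_card _ hBQfin]
    exact Even.neg_one_pow hBQeven
  -- (3) the fibre products as products over the packet's subtype `v.Extension (𝓞 F)`
  have hfib : ∀ v ∈ S,
      (letI := Extension.fintype (𝓞 ℚ) ℚ F (𝓞 F) v; ∏ w : v.Extension (𝓞 F), sF w.1) =
        ∏ w ∈ T with u w = v, sF w := fun v hvS =>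
    prod_extension_eq_prod_filter F v sF T (fun w hw => (hmemT w).2 (by
      change w.under (𝓞 ℚ) ∈ S
      rw [hw]
      exact hvS))
  -- (4) the dyadic place of `ℚ` is unique
  --     (the tree's `Literature.NumberTheory.EllipticCurves.heightOneSpectrum_eq_of_natCast_mem`, re-derived
  --     inline from Mathlib's `Rat.HeightOneSpectrum.primesEquiv` to keep this file's imports light)
  have huniq : ∀ v : HeightOneSpectrum (𝓞 ℚ), (2 : 𝓞 ℚ) ∈ v.asIdeal → v = v₂ := by
    have key : ∀ u : HeightOneSpectrum (𝓞 ℚ), (2 : 𝓞 ℚ) ∈ u.asIdeal →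
        Rat.HeightOneSpectrum.primesEquiv (R := 𝓞 ℚ) u = ⟨2, Nat.prime_two⟩ := by
      intro u hu
      have hmem : ((2 : ℕ) : ℤ) ∈ u.asIdeal.map (Rat.IsIntegralClosure.intEquiv (𝓞 ℚ)) := by
        have h := Ideal.mem_map_of_mem (Rat.IsIntegralClosure.intEquiv (𝓞 ℚ)) hu
        rwa [map_ofNat] at h
      have hdvd : Rat.HeightOneSpectrum.natGenerator u ∣ 2 :=
        (Rat.HeightOneSpectrum.natGenerator_dvd_iff u).2 hmem
      exact Subtype.ext ((Nat.prime_dvd_prime_iff_eq (Rat.HeightOneSpectrum.prime_natGenerator u)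
        Nat.prime_two).1 hdvd)
    intro v hv
    exact (Rat.HeightOneSpectrum.primesEquiv (R := 𝓞 ℚ)).injective (by rw [key v hv, key v₂ hv₂])
  -- (5) at `v ∈ S`, `v ≠ v₂`: the two local factors agree (hypothesis), so their product is `1`
  have hsq : ∀ v, sQ v * sQ v = 1 := fun v => by
    simp only [hsQ]
    rcases hilbertSymbol_eq_one_or_eq_neg_one (F := v.adicCompletion ℚ) (a : v.adicCompletion ℚ)
      (algebraMap ℚ _ (Algebra.norm ℚ β)) with h | h <;> rw [h] <;> norm_num
  have h3 : ∀ v ∈ S.erase v₂, (∏ w ∈ T with u w = v, sF w) * sQ v = 1 := by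
    intro v hv
    obtain ⟨hne, hvS⟩ := Finset.mem_erase.1 hv
    have hv2 : (2 : 𝓞 ℚ) ∉ v.asIdeal := fun h => hne (huniq v h)
    rw [← hfib v hvS, hodd v hv2]
    exact hsq v
  -- (6) assemble: `1 = ∏_{v ∈ S} (∏_{w∣v} sF w) · sQ v = (∏_{w∣v₂} sF w) · sQ v₂`
  have h4 : ∏ v ∈ S, ((∏ w ∈ T with u w = v, sF w) * sQ v) = 1 := by
    rw [Finset.prod_mul_distrib, h1, h2, one_mul]
  rw [← Finset.mul_prod_erase S _ hv₂S, Finset.prod_eq_one h3, mul_one, ← hfib v₂ hv₂S] at h4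
  -- `P · sQ = 1` with `sQ = ±1` gives `P = sQ`
  have h5 := congrArg (· * sQ v₂) h4
  simp only [mul_assoc, hsq v₂, mul_one, one_mul] at h5
  exact h5

end Literature.NumberTheory.QuadraticForms
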